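import Literature.NumberTheory.LFunctions.RudnickSarnakFourierSupport
import HarnessLib

/-!
# Rudnick–Sarnak §4: pulling a test function back along a coincidence pattern (proved)

Proofs only (no definitions, no named facts). Z. Rudnick, P. Sarnak, *Zeros of principal
`L`-functions and random matrix theory*, Duke Math. J. **81** (1996), §4, (4.5)–(4.6) and
(4.14): for a set partition `F` of `{1, …, n}` with `ν` blocks and block map
`ι_F : ℝ^ν → ℝⁿ`, `(ι_F x)_i = x_j` for `i ∈ F_j`, the sums with coincidences along `F` are
`C_F(f, T) = C_ν(ι_F^* f, T)` ((4.6)), and Theorem 3.2 is applied to `ι_F^* f` at level `ν`; for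
this RS note ((4.14)) that `ι_F^* f_Φ = f_{Φ_F}` with
`Φ_F(v) = δ(∑ v) ∫ ∏_j δ(v_j − ∑_{l ∈ F_j} u_l) Φ(u) du`, and that
"`Supp Φ ⊆ {∑ |ξ_j| < r}` implies `Supp Φ_F ⊆ {∑ |v_j| < r}`" (since `∑_j |∑_{l ∈ F_j} u_l| ≤ ∑_l |u_l|`),
so that `Φ_F` is again admissible ("the conditions TF 2, 3 descend to `ι_F f`", p. 307).

Here the block map is a surjection `φ : Fin (k+1) → Fin (m+1)` (`ι_φ^* f (z) = f(z ∘ φ)`;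
for a set partition, `φ = blockIdx`, `RudnickSarnakSieving.lean`), and instead of the explicit
fibre integral `Φ_F` we produce *some* admissible `Φ'` with `f_{Φ'} = ι_φ^* f_Φ`
(`exists_rsPhiTest_comp_surjective`), which is all that the application of Theorem 3.2
(`RSUnrestrictedLimits`, quantified over all admissible `Φ`) requires. The proof:

* `ι_φ^* f_Φ` is diagonal-invariant, and its slice is the Schwartz slice of `f_Φ` composed with
  an injective linear map `L` (injective because `φ` is surjective), hence Schwartz
  (`SchwartzMap.compCLMOfAntilipschitz`);
* its Fourier transform along the hyperplane vanishes on `{|∑ θ_c| + ∑ |θ_c| > 2 − δ}`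
  (`RudnickSarnak.fourier_slice_eq_zero_of_pullback`, `RudnickSarnakFourierSupport.lean`):
  tested against a smooth `ψ` compactly supported there,
  two applications of Fubini and Fourier inversion for `ψ` turn `∫ ψ · (ι_φ^* f_Φ)^` into
  `∫ Φ(ξ(η)) ψ(−Lᵀη) dη`, and `Lᵀη` is the vector of block sums `(∑_{φ j = c} ξ_j)_{c ≥ 1}` of
  `ξ = (−∑η, η)`, with `|∑_c| + ∑_c |·| = ∑_{c} |∑_{φ j = c} ξ_j| ≤ ∑_j |ξ_j| < 2 − δ` on the
  support of `Φ`; so the transform vanishes a.e. on that open set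
  (`IsOpen.ae_eq_zero_of_integral_contDiff_smul_eq_zero`) and everywhere by continuity;
* then `RudnickSarnak.exists_rsPhiTest_eq_of_slice` (`RudnickSarnakProofs.lean`) gives `Φ'`.

Also: `unrestrictedLevelSum_comp_cast`, reindexing the level along `Fin ν = Fin ν'`.

## References

* Z. Rudnick, P. Sarnak, Duke Math. J. 81 (1996), 269–322: (4.5), (4.6), (4.14), p. 307.
-/

noncomputable section

open MeasureTheory Complex Filter Topology SchwartzMap Finset
open scoped FourierTransform RealInnerProductSpace Real ContDiff

namespace Literature.NumberTheory.LFunctions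

/-- Reindexing the level of an unrestricted correlation sum along `Fin ν = Fin ν'`
(`unrestrictedLevelSum`, RS (3.2)). [cite: RudnickSarnak1996, (3.2)] -/
theorem unrestrictedLevelSum_comp_cast {ν ν' : ℕ} (h : ν = ν') (F : (Fin ν' → ℝ) → ℂ) (N : ℕ) :
    unrestrictedLevelSum ν' F N =
      unrestrictedLevelSum ν (fun z ↦ F (fun c' ↦ z (Fin.cast h.symm c'))) N := by
  subst h
  rfl

namespace RudnickSarnak

/-! ## Pull-back of a test function along a surjection of indices -/

/-- Extension by `0` in the coordinate `0`: `z' ↦ (0, z'_1, …, z'_m)`, as a linear map. [folklore] -/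
theorem exists_linearMap_cons_zero (m : ℕ) :
    ∃ E : (Fin m → ℝ) →ₗ[ℝ] (Fin (m + 1) → ℝ), ∀ z' : Fin m → ℝ, E z' = Fin.cons 0 z' := by
  refine ⟨LinearMap.pi fun c : Fin (m + 1) ↦
    Fin.cases (0 : (Fin m → ℝ) →ₗ[ℝ] ℝ) (fun c' ↦ LinearMap.proj c') c, fun z' ↦ ?_⟩
  funext c
  refine Fin.cases ?_ (fun c' ↦ ?_) c
  · simp
  · simp

/-- **Pull-back along a surjection (RS (4.5), (4.14)).** Let `φ : {0,…,k} → {0,…,m}` be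
surjective (the block-index map of a set partition with `m + 1` blocks, `blockIdx`), `Φ` an
admissible function at level `k` whose test function `f_Φ` has a Schwartz slice (TF 3). Then the
pulled-back function `ι_φ^* f_Φ : z ↦ f_Φ(z ∘ φ)` on `ℝ^{m+1}` is again of the form `f_{Φ'}` for
an admissible `Φ'` at level `m`: it is diagonal-invariant, its slice is the Schwartz slice of
`f_Φ` composed with an injective linear map, and its Fourier transform along the hyperplane is
supported in `∑ |v_c| < 2` because `∑_c |∑_{φ j = c} ξ_j| ≤ ∑_j |ξ_j|`
(`fourier_slice_eq_zero_of_pullback`), so `exists_rsPhiTest_eq_of_slice` applies. This is RS's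
"`ι_F^* f_Φ = f_{Φ_F}`, and if `Supp Φ ⊆ {∑ |ξ_j| < r}` then `Supp Φ_F ⊆ {∑ |v_j| < r}`" ((4.14)),
with `Φ'` in place of the explicit fibre integral `Φ_F` (any admissible representative will do:
Theorem 3.2 is applied to `f_{Φ'} = ι_F^* f_Φ`). [cite: RudnickSarnak1996, (4.14)] -/
theorem exists_rsPhiTest_comp_surjective {k m : ℕ} {Φ : (Fin (k + 1) → ℝ) → ℂ}
    (hΦ : IsRSAdmissiblePhi k Φ)
    (hslice : ∃ G : SchwartzMap (Fin k → ℝ) ℂ, ⇑G = rsSlice (rsPhiTest Φ))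
    {φ : Fin (k + 1) → Fin (m + 1)} (hφ : Function.Surjective φ) :
    ∃ Φ' : (Fin (m + 1) → ℝ) → ℂ, IsRSAdmissiblePhi m Φ' ∧
      rsPhiTest Φ' = fun z ↦ rsPhiTest Φ (z ∘ φ) := by
  obtain ⟨G, hG⟩ := hslice
  obtain ⟨δ, hδ, hΦsupp⟩ := hΦ.support_subset
  obtain ⟨E, hE⟩ := exists_linearMap_cons_zero m
  set f := rsPhiTest Φ with hf
  set g : (Fin (m + 1) → ℝ) → ℂ := fun z ↦ f (z ∘ φ) with hg
  -- the linear map `L z' = ((0,z')(φ (i+1)) − (0,z')(φ 0))_i`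
  set Lₗ : (Fin m → ℝ) →ₗ[ℝ] (Fin k → ℝ) :=
    LinearMap.pi fun i : Fin k ↦
      ((LinearMap.proj (φ i.succ) : (Fin (m + 1) → ℝ) →ₗ[ℝ] ℝ) - LinearMap.proj (φ 0)) ∘ₗ E
    with hLₗ
  have hLapply : ∀ (z' : Fin m → ℝ) (i : Fin k),
      Lₗ z' i = (Fin.cons 0 z' : Fin (m + 1) → ℝ) (φ i.succ) - (Fin.cons 0 z' : Fin (m + 1) → ℝ) (φ 0) := by
    intro z' i
    simp [hLₗ, hE]
  set L : (Fin m → ℝ) →L[ℝ] (Fin k → ℝ) := LinearMap.toContinuousLinearMap Lₗ with hL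
  have hLcoe : ∀ z', L z' = Lₗ z' := fun z' ↦ rfl
  -- `L` is injective
  have hLinj : Function.Injective L := by
    intro z₁ z₂ h12
    have h0 : L (z₁ - z₂) = 0 := by rw [map_sub, h12, sub_self]
    suffices hz : z₁ - z₂ = 0 from sub_eq_zero.1 hz
    set z' := z₁ - z₂ with hz'
    have hall : ∀ c, (Fin.cons 0 z' : Fin (m + 1) → ℝ) c =
        (Fin.cons 0 z' : Fin (m + 1) → ℝ) (φ 0) := by
      intro c
      obtain ⟨a, rfl⟩ := hφ c
      refine Fin.cases rfl (fun i ↦ ?_) a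
      have := congrFun h0 i
      rw [hLcoe, hLapply] at this
      simpa [sub_eq_zero] using this
    have hzero : (Fin.cons 0 z' : Fin (m + 1) → ℝ) (φ 0) = 0 := by
      rw [← hall 0, Fin.cons_zero]
    funext c'
    have := hall c'.succ
    rw [hzero, Fin.cons_succ] at this
    simpa using this
  obtain ⟨K, -, hK⟩ := L.toLinearMap.exists_antilipschitzWith
    (LinearMap.ker_eq_bot.2 hLinj)
  -- the slice of `g` is `G ∘ L`
  set G' : SchwartzMap (Fin m → ℝ) ℂ :=
    SchwartzMap.compCLMOfAntilipschitz ℝ L.hasTemperateGrowth hK G with hG'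
  have hG'apply : ∀ z', G' z' = G (L z') := fun z' ↦ rfl
  have hfx : ∀ x : Fin (k + 1) → ℝ, f x = G (fun i ↦ x i.succ - x 0) := by
    intro x
    have h1 : f x = f (fun a ↦ x a + -x 0) := (rsPhiTest_add_const Φ x (-x 0)).symm
    have h2 : (fun a ↦ x a + -x 0) = Fin.cons 0 (fun i ↦ x i.succ - x 0) := by
      funext a
      refine Fin.cases ?_ (fun l ↦ ?_) a
      · simp
      · simp [sub_eq_add_neg]
    rw [h1, h2, show f (Fin.cons 0 fun i ↦ x i.succ - x 0) = rsSlice f (fun i ↦ x i.succ - x 0)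
      from rfl, ← hG]
  have hG'slice : (⇑G' : (Fin m → ℝ) → ℂ) = rsSlice g := by
    funext z'
    rw [hG'apply, show rsSlice g z' = f ((Fin.cons 0 z' : Fin (m + 1) → ℝ) ∘ φ) from rfl, hfx]
    congr 1
    funext i
    rw [hLcoe, hLapply]
    rfl
  -- diagonal invariance of `g`
  have hdiag : ∀ (z : Fin (m + 1) → ℝ) (t : ℝ), g (fun c ↦ z c + t) = g z := by
    intro z t
    exact rsPhiTest_add_const Φ (z ∘ φ) t
  -- the function `Φ_H` on the hyperplane and its properties
  set ΦH : (Fin k → ℝ) → ℂ := fun η ↦ Φ (Fin.cons (-∑ i, η i) η) with hΦH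
  have hconsc : Continuous fun η : Fin k → ℝ ↦ (Fin.cons (-∑ i, η i) η : Fin (k + 1) → ℝ) := by
    refine continuous_pi fun a ↦ ?_
    refine Fin.cases ?_ (fun i ↦ ?_) a
    · simp only [Fin.cons_zero]
      fun_prop
    · simp only [Fin.cons_succ]
      fun_prop
  have hΦHc : Continuous ΦH := hΦ.contDiff.continuous.comp hconsc
  have hΦHs : HasCompactSupport ΦH := by
    refine HasCompactSupport.of_support_subset_isCompact (isCompact_closedBall (0 : Fin k → ℝ) 2)
      fun η hη ↦ ?_
    rw [Metric.mem_closedBall, dist_zero_right]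
    by_contra hlt
    have h2 : 2 ≤ ‖(Fin.cons (-∑ i, η i) η : Fin (k + 1) → ℝ)‖ := by
      refine (not_le.1 hlt).le.trans ?_
      refine (pi_norm_le_iff_of_nonneg (norm_nonneg _)).2 fun i ↦ ?_
      have := norm_le_pi_norm (Fin.cons (-∑ i, η i) η : Fin (k + 1) → ℝ) i.succ
      simpa using this
    exact hη (hΦ.eq_zero_of_le_norm h2)
  have hgs : ∀ z : Fin m → ℝ, G' z =
      ∫ η : Fin k → ℝ, ΦH η * Complex.exp (-(2 * π * I * ∑ i, ((L z) i * η i : ℝ))) := by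
    intro z
    rw [hG'apply, show G (L z) = rsSlice f (L z) by rw [← hG], hf, rsSlice_rsPhiTest]
  -- the support transfer `∑_c |∑_{φ j = c} ξ_j| ≤ ∑_j |ξ_j|`
  have hB : ∀ η : Fin k → ℝ, ΦH η ≠ 0 →
      |∑ c : Fin m, -(∑ i, (L (Pi.single c 1)) i * η i)| +
        ∑ c : Fin m, |-(∑ i, (L (Pi.single c 1)) i * η i)| < 2 - δ := by
    intro η hη
    set ξ : Fin (k + 1) → ℝ := Fin.cons (-∑ i, η i) η with hξ
    -- `A c'' = ∑_{φ j = c''} ξ_j`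
    set A : Fin (m + 1) → ℝ := fun c'' ↦ ∑ j, if φ j = c'' then ξ j else 0 with hA
    have hLe : ∀ (c : Fin m) (i : Fin k), (L (Pi.single c 1)) i =
        (if φ i.succ = c.succ then (1 : ℝ) else 0) - (if φ 0 = c.succ then (1 : ℝ) else 0) := by
      intro c i
      rw [hLcoe, hLapply]
      have hcons : ∀ c'' : Fin (m + 1), (Fin.cons 0 (Pi.single c (1 : ℝ)) : Fin (m + 1) → ℝ) c'' =
          if c'' = c.succ then 1 else 0 := by
        intro c''
        refine Fin.cases ?_ (fun c' ↦ ?_) c''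
        · simp [(Fin.succ_ne_zero c).symm]
        · simp [Pi.single_apply, Fin.succ_inj]
      rw [hcons, hcons]
    have hBA : ∀ c : Fin m, ∑ i, (L (Pi.single c 1)) i * η i = A c.succ := by
      intro c
      have h0 : ∑ i : Fin k, (if φ 0 = c.succ then η i else 0) =
          if φ 0 = c.succ then ∑ i, η i else 0 := by
        split_ifs <;> simp
      have hR : A c.succ = (if φ 0 = c.succ then -∑ i, η i else 0) +
          ∑ i : Fin k, (if φ i.succ = c.succ then η i else 0) := by
        simp only [hA]
        rw [Fin.sum_univ_succ]
        simp [hξ]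
      have hLsum : ∑ i, (L (Pi.single c 1)) i * η i =
          ∑ i : Fin k, (if φ i.succ = c.succ then η i else 0) -
            ∑ i : Fin k, (if φ 0 = c.succ then η i else 0) := by
        rw [← Finset.sum_sub_distrib]
        refine Finset.sum_congr rfl fun i _ ↦ ?_
        rw [hLe]
        split_ifs <;> ring
      rw [hLsum, h0, hR]
      split_ifs <;> ring
    have hAsum : ∑ c'', A c'' = ∑ j, ξ j := by
      simp only [hA]
      rw [Finset.sum_comm]
      refine Finset.sum_congr rfl fun j _ ↦ ?_
      rw [Finset.sum_ite_eq]
      simp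
    have hξsum : ∑ j, ξ j = 0 := by
      rw [Fin.sum_univ_succ]
      simp [hξ]
    have hA0 : ∑ c : Fin m, A c.succ = -A 0 := by
      have := hAsum
      rw [hξsum, Fin.sum_univ_succ] at this
      linarith
    have habsA : ∀ c'', |A c''| ≤ ∑ j, if φ j = c'' then |ξ j| else 0 := by
      intro c''
      simp only [hA]
      refine (Finset.abs_sum_le_sum_abs _ _).trans (le_of_eq ?_)
      refine Finset.sum_congr rfl fun j _ ↦ ?_
      split_ifs <;> simp
    have hsumabs : ∑ c'', (∑ j, if φ j = c'' then |ξ j| else 0) = ∑ j, |ξ j| := by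
      rw [Finset.sum_comm]
      refine Finset.sum_congr rfl fun j _ ↦ ?_
      rw [Finset.sum_ite_eq]
      simp
    have hξlt : ∑ j, |ξ j| < 2 - δ := by
      by_contra hge
      exact hη (hΦsupp ξ (not_lt.1 hge))
    calc |∑ c : Fin m, -(∑ i, (L (Pi.single c 1)) i * η i)| +
          ∑ c : Fin m, |-(∑ i, (L (Pi.single c 1)) i * η i)|
        = |A 0| + ∑ c : Fin m, |A c.succ| := by
          simp only [hBA, Finset.sum_neg_distrib, abs_neg, hA0, neg_neg]
      _ = ∑ c'', |A c''| := (Fin.sum_univ_succ (fun c'' ↦ |A c''|)).symm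
      _ ≤ ∑ c'', ∑ j, if φ j = c'' then |ξ j| else 0 := Finset.sum_le_sum fun c'' _ ↦ habsA c''
      _ = ∑ j, |ξ j| := hsumabs
      _ < 2 - δ := hξlt
  -- restricted Fourier support of `g`
  have hsupp' : HasRSFourierSupport m g := by
    refine ⟨δ / 2, by positivity, fun θ hθ ↦ ?_⟩
    have hθ' : 2 - δ < |∑ c, θ c| + ∑ c, |θ c| := by linarith
    unfold rsSliceFourier
    rw [← hG'slice]
    exact fourier_slice_eq_zero_of_pullback hΦHc hΦHs L G' hgs hB θ hθ'
  exact exists_rsPhiTest_eq_of_slice hdiag ⟨G', hG'slice⟩ hsupp'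

end RudnickSarnak

end Literature.NumberTheory.LFunctions

end
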